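import Literature.Algebra.Polynomial.ThetaBodies
import HarnessLib

/-!
# Theta bodies of finite point sets are exact (Gouveia–Thomas, BPT Theorems 7.26 and 7.30)

[cite: BlekhermanParriloThomas2012, Ch. 7 (J. Gouveia and R. R. Thomas, *Convex hulls of
algebraic sets*), §7.3.1 Theorem 7.26 and its proof (pp. 317–318), Definition 7.28 and
Theorem 7.30 with its proof (pp. 318–319), Exercises 7.55 (p. 329) and 7.65 (p. 337); §7.2 p. 296
(first display:
`cl(conv(V_ℝ(I)))` is the intersection of the half-spaces `l ≥ 0` valid on `V_ℝ(I)`);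
§7.2.2 p. 306 (vanishing ideals `I(S)` of finite sets `S`)]

**Theorem 7.26.** If `V_ℝ(I)` is finite then `TH_k(I) = conv(V_ℝ(I))` for some `k`.  The printed
proof reduces to the real radical `J = I(V_ℝ(I))` (Theorem 7.17) and then argues: writing
`V_ℝ(I) = {P_1, …, P_m}` and choosing interpolators `q_i` with `q_i(P_i) = 1`, `q_i(P_j) = 0`
(`j ≠ i`), every polynomial `f ≥ 0` on `V_ℝ(I)` satisfies
`f − ∑_j (√f(P_j) q_j)² ∈ J`, so `f` is sos modulo `J`; hence every linear inequality valid on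
the polytope `conv(V_ℝ(I))` is valid on `TH_k(J)`.

We formalise this argument for the vanishing ideal `I(S)` (Mathlib's
`MvPolynomial.vanishingIdeal ℝ S`) of an arbitrary finite set `S ⊆ ℝⁿ` — the setting of §7.2.2
p. 306 and §7.4, where `I = I(S)` is the ideal at hand — with an explicit exponent: the Lagrange
interpolators `interpPoly S P` (products of affine separators) have degree `≤ |S| − 1`, so every
`f ≥ 0` on `S` is `(|S| − 1)`-sos mod `I(S)` (`isKSosMod_vanishingIdeal_of_nonneg`), and therefore
`TH_{|S|−1}(I(S)) = conv(S)` (`thetaBody_vanishingIdeal_eq_convexHull`; the inclusion `⊆` uses the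
half-space description of `conv(S)`, p. 296, via Mathlib's `geometric_hahn_banach_closed_point`).
In the language of Definition 7.25, `I(S)` is `TH_{|S|−1}`-exact (`isThetaExact_vanishingIdeal`).

**Theorem 7.30** (sufficiency half, same mechanism): if `conv(S)` is a 2-level polytope
(Definition 7.28) — every facet functional `f_t` takes only the values `0, λ_t` on `S` — then
`f_t (f_t − λ_t) ∈ I(S)`, so `f_t ≡ f_t²/λ_t` is `1`-sos mod `I(S)` and `TH_1(I(S)) = conv(S)`
(`isKSosMod_one_vanishingIdeal_of_twoLevel`, `thetaBody_one_vanishingIdeal_eq_of_twoLevel`,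
`isThetaExact_one_vanishingIdeal_of_twoLevel`; the facet description of `conv(S)` is an explicit
hypothesis), and its `(k+1)`-level version **Exercise 7.55** (`TH_k`-exactness; Lagrange
interpolation of `√` on the level set: `exists_sq_sub_mem_vanishingIdeal_of_levels`,
`isKSosMod_vanishingIdeal_of_levels`, `thetaBody_vanishingIdeal_eq_of_levels`,
`isThetaExact_vanishingIdeal_of_levels`).

Not formalised: the reduction of a general ideal with finite real variety to its real radical
(Theorem 7.17), Lemma 7.27 and the necessity half of Theorem 7.30 (`TH_1`-exact ⇒ 2-level).
-/

noncomputable section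

open MvPolynomial Finset Matrix

namespace Literature.Algebra.Polynomial.ThetaBodiesFinite

open Literature.Algebra.Polynomial.ThetaBodies

variable {σ : Type*} [Fintype σ]

/-! ### Lagrange interpolators of a finite point set (proof of Theorem 7.26) -/

/-- The affine separator `ℓ_{P,Q}(x) = ⟨P − Q, x − Q⟩ / ⟨P − Q, P − Q⟩` of two points: `ℓ(P) = 1`
(if `P ≠ Q`), `ℓ(Q) = 0`. [cite: BlekhermanParriloThomas2012, Ch. 7 §7.3.1, proof of
Theorem 7.26 (the interpolators `q_i`)] -/
def affineSep (P Q : σ → ℝ) : MvPolynomial σ ℝ :=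
  C (1 / ((P - Q) ⬝ᵥ (P - Q))) * ∑ i, C (P i - Q i) * (X i - C (Q i))

/-- `ℓ_{P,Q}(x) = ⟨P − Q, x − Q⟩ / ⟨P − Q, P − Q⟩`.
[cite: BlekhermanParriloThomas2012, Ch. 7 §7.3.1, proof of Theorem 7.26] -/
theorem eval_affineSep (P Q x : σ → ℝ) :
    eval x (affineSep P Q) = ((P - Q) ⬝ᵥ (x - Q)) / ((P - Q) ⬝ᵥ (P - Q)) := by
  simp only [affineSep, map_mul, eval_C, map_sum, map_sub, eval_X, dotProduct, Pi.sub_apply]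
  rw [one_div, inv_mul_eq_div]

/-- `ℓ_{P,Q}(P) = 1` for `P ≠ Q`.
[cite: BlekhermanParriloThomas2012, Ch. 7 §7.3.1, proof of Theorem 7.26] -/
theorem eval_affineSep_self {P Q : σ → ℝ} (h : P ≠ Q) : eval P (affineSep P Q) = 1 := by
  rw [eval_affineSep, div_self]
  exact fun h0 => h (sub_eq_zero.mp (dotProduct_self_eq_zero.mp h0))

/-- `ℓ_{P,Q}(Q) = 0`. [cite: BlekhermanParriloThomas2012, Ch. 7 §7.3.1, proof of Theorem 7.26] -/
theorem eval_affineSep_right (P Q : σ → ℝ) : eval Q (affineSep P Q) = 0 := by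
  rw [eval_affineSep, sub_self, dotProduct_zero, zero_div]

/-- `deg ℓ_{P,Q} ≤ 1`. [cite: BlekhermanParriloThomas2012, Ch. 7 §7.3.1, proof of Theorem 7.26] -/
theorem totalDegree_affineSep_le (P Q : σ → ℝ) : (affineSep P Q).totalDegree ≤ 1 := by
  refine (totalDegree_mul _ _).trans ?_
  rw [totalDegree_C, zero_add]
  refine (totalDegree_finsetSum _ _).trans (Finset.sup_le fun i _ => ?_)
  refine (totalDegree_mul _ _).trans ?_
  rw [totalDegree_C, zero_add]
  refine (totalDegree_sub _ _).trans (max_le (totalDegree_X (R := ℝ) i).le ?_)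
  rw [totalDegree_C]
  exact Nat.zero_le _

variable [DecidableEq (σ → ℝ)]

/-- The Lagrange interpolator `q_P := ∏_{Q ∈ S ∖ {P}} ℓ_{P,Q}` of the finite point set `S` at `P`
("let `q_i` be a polynomial such that `q_i(P_i) = 1` and `q_i(P_j) = 0` for `j ≠ i`").
[cite: BlekhermanParriloThomas2012, Ch. 7 §7.3.1, proof of Theorem 7.26] -/
def interpPoly (S : Finset (σ → ℝ)) (P : σ → ℝ) : MvPolynomial σ ℝ :=
  ∏ Q ∈ S.erase P, affineSep P Q

/-- `q_P(P) = 1`. [cite: BlekhermanParriloThomas2012, Ch. 7 §7.3.1, proof of Theorem 7.26] -/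
theorem eval_interpPoly_self (S : Finset (σ → ℝ)) (P : σ → ℝ) :
    eval P (interpPoly S P) = 1 := by
  rw [interpPoly, map_prod]
  exact Finset.prod_eq_one fun Q hQ => eval_affineSep_self (Finset.ne_of_mem_erase hQ).symm

/-- `q_P(Q) = 0` for `Q ∈ S`, `Q ≠ P`.
[cite: BlekhermanParriloThomas2012, Ch. 7 §7.3.1, proof of Theorem 7.26] -/
theorem eval_interpPoly_of_ne {S : Finset (σ → ℝ)} {P Q : σ → ℝ} (hQ : Q ∈ S) (hne : Q ≠ P) :
    eval Q (interpPoly S P) = 0 := by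
  rw [interpPoly, map_prod]
  exact Finset.prod_eq_zero (Finset.mem_erase.mpr ⟨hne, hQ⟩) (eval_affineSep_right P Q)

/-- `deg q_P ≤ |S| − 1` for `P ∈ S`.
[cite: BlekhermanParriloThomas2012, Ch. 7 §7.3.1, proof of Theorem 7.26] -/
theorem totalDegree_interpPoly_le {S : Finset (σ → ℝ)} {P : σ → ℝ} (hP : P ∈ S) :
    (interpPoly S P).totalDegree ≤ S.card - 1 := by
  refine (totalDegree_finsetProd _ _).trans ?_
  calc ∑ Q ∈ S.erase P, (affineSep P Q).totalDegree ≤ ∑ Q ∈ S.erase P, 1 :=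
        Finset.sum_le_sum fun Q _ => totalDegree_affineSep_le P Q
    _ = S.card - 1 := by
        rw [Finset.sum_const, smul_eq_mul, mul_one, Finset.card_erase_of_mem hP]

/-! ### Nonnegative polynomials on `S` are `(|S| − 1)`-sos modulo `I(S)` -/

/-- The key step of the proof of Theorem 7.26: for `f ≥ 0` on the finite set `S`, the polynomial
`f − ∑_{P ∈ S} (√f(P) · q_P)²` vanishes at every point of `S`, i.e. lies in the vanishing ideal
`I(S)`. [cite: BlekhermanParriloThomas2012, Ch. 7 §7.3.1, proof of Theorem 7.26] -/
theorem sub_sum_sq_mem_vanishingIdeal (S : Finset (σ → ℝ)) (f : MvPolynomial σ ℝ)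
    (hf : ∀ P ∈ S, 0 ≤ eval P f) :
    f - ∑ P : S, (C (Real.sqrt (eval (P : σ → ℝ) f)) * interpPoly S P) ^ 2 ∈
      vanishingIdeal ℝ (S : Set (σ → ℝ)) := by
  rw [mem_vanishingIdeal_iff]
  intro x hx
  rw [aeval_eq_eval, map_sub, map_sum, sub_eq_zero]
  rw [Finset.sum_eq_single ⟨x, hx⟩]
  · simp only [map_pow, map_mul, eval_C, eval_interpPoly_self, mul_one]
    rw [Real.sq_sqrt (hf x hx)]
  · intro P _ hP
    have hne : x ≠ (P : σ → ℝ) := fun h => hP (Subtype.ext h.symm)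
    rw [map_pow, map_mul, eval_interpPoly_of_ne hx hne, mul_zero, zero_pow two_ne_zero]
  · exact fun h => (h (Finset.mem_univ _)).elim

/-- Proof of **Theorem 7.26**, quantitative form for vanishing ideals: every polynomial that is
nonnegative on the finite set `S` is `(|S| − 1)`-sos modulo `I(S)` ("all nonnegative polynomials
on `V_ℝ(J)` are sos modulo `J`"). [cite: BlekhermanParriloThomas2012, Ch. 7 §7.3.1, proof of
Theorem 7.26] -/
theorem isKSosMod_vanishingIdeal_of_nonneg (S : Finset (σ → ℝ)) {f : MvPolynomial σ ℝ}
    (hf : ∀ P ∈ S, 0 ≤ eval P f) :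
    IsKSosMod (vanishingIdeal ℝ (S : Set (σ → ℝ))) (S.card - 1) f :=
  isKSosMod_of_eq' (fun P : S => C (Real.sqrt (eval (P : σ → ℝ) f)) * interpPoly S P)
    (fun P => (totalDegree_mul _ _).trans (by
      rw [totalDegree_C, zero_add]; exact totalDegree_interpPoly_le P.2))
    (sub_sum_sq_mem_vanishingIdeal S f hf) (by rw [add_sub_cancel])

/-! ### `TH_{|S|−1}(I(S)) = conv(S)` -/

omit [Fintype σ] [DecidableEq (σ → ℝ)] in
/-- `S ⊆ V_ℝ(I(S))`. [cite: BlekhermanParriloThomas2012, Ch. 7 §7.2.2, p. 306] -/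
theorem subset_zeroLocus_vanishingIdeal (S : Set (σ → ℝ)) :
    S ⊆ zeroLocus ℝ (vanishingIdeal ℝ S) :=
  fun _ hx _ hp => (mem_vanishingIdeal_iff.mp hp) _ hx

omit [DecidableEq (σ → ℝ)] in
/-- A finite set is a real variety: `V_ℝ(I(S)) = S` for finite `S` (the polynomial
`∏_{P ∈ S} ‖x − P‖²` lies in `I(S)` and vanishes only on `S`).
[cite: BlekhermanParriloThomas2012, Ch. 7 §7.2.2, p. 306 (`I(S)`, `S` finite, has real
variety `S`)] -/
theorem zeroLocus_vanishingIdeal_eq (S : Finset (σ → ℝ)) :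
    zeroLocus ℝ (vanishingIdeal ℝ (S : Set (σ → ℝ))) = S := by
  refine Set.Subset.antisymm (fun x hx => ?_) (subset_zeroLocus_vanishingIdeal _)
  have hg : (∏ P ∈ S, ∑ i, (X i - C (P i)) ^ 2 : MvPolynomial σ ℝ) ∈
      vanishingIdeal ℝ (S : Set (σ → ℝ)) := by
    rw [mem_vanishingIdeal_iff]
    intro P hP
    rw [aeval_eq_eval, map_prod]
    exact Finset.prod_eq_zero (Finset.mem_coe.mp hP) (by simp)
  have h0 := hx _ hg
  rw [aeval_eq_eval, map_prod, Finset.prod_eq_zero_iff] at h0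
  obtain ⟨P, hP, hP0⟩ := h0
  rw [map_sum, Finset.sum_eq_zero_iff_of_nonneg fun i _ => by
    rw [map_pow]; exact sq_nonneg _] at hP0
  have hxP : x = P := funext fun i => by
    have := hP0 i (Finset.mem_univ i)
    simp only [map_pow, map_sub, eval_X, eval_C] at this
    exact sub_eq_zero.mp (pow_eq_zero_iff two_ne_zero |>.mp this)
  rw [hxP]
  exact Finset.mem_coe.mpr hP

omit [DecidableEq (σ → ℝ)] in
/-- `conv(S) ⊆ TH_k(I(S))` for every `k`. [cite: BlekhermanParriloThomas2012, Ch. 7 §7.2,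
p. 297 (`cl(conv(V_ℝ(I))) ⊆ TH_k(I)`)] -/
theorem convexHull_subset_thetaBody_vanishingIdeal (S : Set (σ → ℝ)) (k : ℕ) :
    convexHull ℝ S ⊆ thetaBody (vanishingIdeal ℝ S) k :=
  convexHull_min ((subset_zeroLocus_vanishingIdeal S).trans zeroLocus_subset_thetaBody)
    convex_thetaBody

omit [DecidableEq (σ → ℝ)] in
/-- A continuous linear functional on `ℝⁿ` is `y ↦ ∑_i φ(e_i) y_i`. [folklore] -/
private theorem strongDual_apply [DecidableEq σ] (φ : StrongDual ℝ (σ → ℝ)) (y : σ → ℝ) :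
    φ y = (fun i => φ (fun j => if i = j then 1 else 0)) ⬝ᵥ y := by
  have := LinearMap.pi_apply_eq_sum_univ (φ : (σ → ℝ) →ₗ[ℝ] ℝ) y
  simpa [dotProduct, mul_comm] using this

/-- `TH_{|S|−1}(I(S)) ⊆ conv(S)`: a point outside the polytope `conv(S)` is cut off by a linear
inequality `l ≥ 0` valid on `S` (the half-space description of `cl(conv(V_ℝ(I)))`, p. 296),
and such an `l` is `(|S| − 1)`-sos mod `I(S)`, hence valid on the theta body.
[cite: BlekhermanParriloThomas2012, Ch. 7 §7.3.1, proof of Theorem 7.26, with §7.2 p. 296] -/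
theorem thetaBody_vanishingIdeal_subset_convexHull (S : Finset (σ → ℝ)) :
    thetaBody (vanishingIdeal ℝ (S : Set (σ → ℝ))) (S.card - 1) ⊆
      convexHull ℝ (S : Set (σ → ℝ)) := by
  classical
  intro x hx
  by_contra hxS
  obtain ⟨φ, u, hφ, hu⟩ := geometric_hahn_banach_closed_point (convex_convexHull ℝ _)
    (Set.Finite.isCompact_convexHull ℝ S.finite_toSet).isClosed hxS
  set a : σ → ℝ := fun i => -φ (fun j => if i = j then 1 else 0) with ha
  have hφ' : ∀ y : σ → ℝ, φ y = -(a ⬝ᵥ y) := fun y => by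
    rw [strongDual_apply φ y, ha]
    simp [dotProduct]
  have hl : IsKSosMod (vanishingIdeal ℝ (S : Set (σ → ℝ))) (S.card - 1) (affinePoly u a) :=
    isKSosMod_vanishingIdeal_of_nonneg S fun P hP => by
      rw [eval_affinePoly]
      have h := hφ P (subset_convexHull ℝ _ (Finset.mem_coe.mpr hP))
      rw [hφ'] at h
      linarith
  have h0 := hx u a hl
  rw [hφ'] at hu
  linarith

/-- **Theorem 7.26** (finite varieties, vanishing-ideal form with explicit exponent):
`TH_{|S|−1}(I(S)) = conv(S)` for every finite `S ⊆ ℝⁿ`.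
[cite: BlekhermanParriloThomas2012, Ch. 7 §7.3.1 Theorem 7.26] -/
theorem thetaBody_vanishingIdeal_eq_convexHull (S : Finset (σ → ℝ)) :
    thetaBody (vanishingIdeal ℝ (S : Set (σ → ℝ))) (S.card - 1) =
      convexHull ℝ (S : Set (σ → ℝ)) :=
  Set.Subset.antisymm (thetaBody_vanishingIdeal_subset_convexHull S)
    (convexHull_subset_thetaBody_vanishingIdeal _ _)

/-- … and `TH_k(I(S)) = conv(S)` for every `k ≥ |S| − 1`.
[cite: BlekhermanParriloThomas2012, Ch. 7 §7.3.1 Theorem 7.26 with §7.2 p. 297] -/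
theorem thetaBody_vanishingIdeal_eq_convexHull_of_le (S : Finset (σ → ℝ)) {k : ℕ}
    (hk : S.card - 1 ≤ k) :
    thetaBody (vanishingIdeal ℝ (S : Set (σ → ℝ))) k = convexHull ℝ (S : Set (σ → ℝ)) :=
  Set.Subset.antisymm
    ((thetaBody_antitone hk).trans (thetaBody_vanishingIdeal_subset_convexHull S))
    (convexHull_subset_thetaBody_vanishingIdeal _ _)

/-- **Theorem 7.26** in the language of Definition 7.25: the vanishing ideal of a finite set
`S ⊆ ℝⁿ` is `TH_{|S|−1}`-exact. [cite: BlekhermanParriloThomas2012, Ch. 7 §7.3.1 Theorem 7.26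
and the remark after its proof ("the ideal `I` is `TH_k`-exact for some finite `k`")] -/
theorem isThetaExact_vanishingIdeal (S : Finset (σ → ℝ)) :
    IsThetaExact (vanishingIdeal ℝ (S : Set (σ → ℝ))) (S.card - 1) := by
  rw [IsThetaExact, zeroLocus_vanishingIdeal_eq,
    (Set.Finite.isCompact_convexHull ℝ S.finite_toSet).isClosed.closure_eq]
  exact thetaBody_vanishingIdeal_eq_convexHull S

/-- Hence the theta body sequence of `I(S)` converges (finitely) to `conv(S)`.
[cite: BlekhermanParriloThomas2012, Ch. 7 §7.3.1 Theorem 7.26 ("finite convergence of the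
theta body sequence of `I` when `V_ℝ(I)` is finite")] -/
theorem thetaConverges_vanishingIdeal (S : Finset (σ → ℝ)) :
    ThetaConverges (vanishingIdeal ℝ (S : Set (σ → ℝ))) :=
  (isThetaExact_vanishingIdeal S).thetaConverges

/-! ### Theorem 7.30 (sufficiency): vertex sets of 2-level polytopes are `TH_1`-exact -/

omit [DecidableEq (σ → ℝ)] in
/-- The mechanism of the proof of **Theorem 7.30** (2-level ⇒ `TH_1`-exact): if an affine
function `f = α + ⟨a, x⟩` takes only the two values `0` and `c > 0` on `S` ("all points `P ∈ S`
must satisfy `f(P) = 0` or `f(P) = λ`"), then `f (f − c)` vanishes on `S`, so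
`f ≡ (1/c) f²  mod I(S)` and `f` is `1`-sos modulo the vanishing ideal `I(S)`.
[cite: BlekhermanParriloThomas2012, Ch. 7 §7.3.1, Theorem 7.30 and its proof (second
paragraph); Definition 7.28 (2-level)] -/
theorem isKSosMod_one_vanishingIdeal_of_twoLevel (S : Set (σ → ℝ)) {α c : ℝ} {a : σ → ℝ}
    (hc : 0 < c) (h2 : ∀ x ∈ S, α + a ⬝ᵥ x = 0 ∨ α + a ⬝ᵥ x = c) :
    IsKSosMod (vanishingIdeal ℝ S) 1 (affinePoly α a) := by
  have hp : affinePoly α a - C (1 / c) * affinePoly α a ^ 2 ∈ vanishingIdeal ℝ S := by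
    rw [mem_vanishingIdeal_iff]
    intro x hx
    rw [aeval_eq_eval, map_sub, map_mul, map_pow, eval_C, eval_affinePoly]
    rcases h2 x hx with h | h
    · rw [h]; ring
    · rw [h]; field_simp; ring
  refine isKSosMod_of_eq (fun _ : Fin 1 => C (1 / Real.sqrt c) * affinePoly α a)
    (fun _ => (totalDegree_mul _ _).trans (by
      rw [totalDegree_C, zero_add]; exact totalDegree_affinePoly_le α a)) hp ?_
  have hs : (1 / Real.sqrt c) ^ 2 = 1 / c := by rw [div_pow, one_pow, Real.sq_sqrt hc.le]
  rw [Fin.sum_univ_one, mul_pow, ← map_pow, hs]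
  ring

omit [DecidableEq (σ → ℝ)] in
/-- **Theorem 7.30**, sufficiency half, with the facet description as an explicit hypothesis: if
`cl(conv(S)) = {x : f_t(x) ≥ 0 (t ∈ T)}` for affine functions `f_t = α_t + ⟨a_t, x⟩` each of
which takes only the values `0` and `λ_t > 0` on `S` (i.e. `conv(S)` is a 2-level polytope when
`S` is finite and the `f_t` are its facet inequalities), then `TH_1(I(S)) = cl(conv(S))`.
[cite: BlekhermanParriloThomas2012, Ch. 7 §7.3.1, Theorem 7.30 and its proof; Definition 7.28] -/
theorem thetaBody_one_vanishingIdeal_eq_of_twoLevel (S : Set (σ → ℝ)) {T : Type*} (α : T → ℝ)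
    (a : T → σ → ℝ) (c : T → ℝ) (hc : ∀ t, 0 < c t)
    (h2 : ∀ t, ∀ x ∈ S, α t + a t ⬝ᵥ x = 0 ∨ α t + a t ⬝ᵥ x = c t)
    (hP : closure (convexHull ℝ S) = {x | ∀ t, 0 ≤ α t + a t ⬝ᵥ x}) :
    thetaBody (vanishingIdeal ℝ S) 1 = closure (convexHull ℝ S) := by
  refine Set.Subset.antisymm (fun x hx => ?_) ?_
  · rw [hP]
    exact fun t => hx (α t) (a t) (isKSosMod_one_vanishingIdeal_of_twoLevel S (hc t) (h2 t))
  · exact (closure_mono (convexHull_mono (subset_zeroLocus_vanishingIdeal S))).trans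
      closure_convexHull_zeroLocus_subset_thetaBody

omit [DecidableEq (σ → ℝ)] in
/-- **Theorem 7.30**, sufficiency half, for a finite vertex set `S` (`I(S)` is then real radical
with `V_ℝ(I(S)) = S`): if `conv(S) = {x : f_t(x) ≥ 0}` with every `f_t` two-valued `{0, λ_t}`,
`λ_t > 0`, on `S` — "`S` is the set of vertices of a 2-level polytope" — then `I(S)` is
`TH_1`-exact. [cite: BlekhermanParriloThomas2012, Ch. 7 §7.3.1, Theorem 7.30 (the direction
"2-level ⇒ `TH_1`-exact") and its proof; Definition 7.28] -/
theorem isThetaExact_one_vanishingIdeal_of_twoLevel (S : Finset (σ → ℝ)) {T : Type*}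
    (α : T → ℝ) (a : T → σ → ℝ) (c : T → ℝ) (hc : ∀ t, 0 < c t)
    (h2 : ∀ t, ∀ x ∈ S, α t + a t ⬝ᵥ x = 0 ∨ α t + a t ⬝ᵥ x = c t)
    (hP : convexHull ℝ (S : Set (σ → ℝ)) = {x | ∀ t, 0 ≤ α t + a t ⬝ᵥ x}) :
    IsThetaExact (vanishingIdeal ℝ (S : Set (σ → ℝ))) 1 := by
  have hcl : closure (convexHull ℝ (S : Set (σ → ℝ))) = convexHull ℝ (S : Set (σ → ℝ)) :=
    (Set.Finite.isCompact_convexHull ℝ S.finite_toSet).isClosed.closure_eq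
  rw [IsThetaExact, zeroLocus_vanishingIdeal_eq, hcl]
  have h := thetaBody_one_vanishingIdeal_eq_of_twoLevel (S : Set (σ → ℝ)) α a c hc
    (fun t x hx => h2 t x (Finset.mem_coe.mp hx)) (by rw [hcl, hP])
  rw [h, hcl]

/-! ### Exercise 7.55: vertex sets of `(k+1)`-level polytopes are `TH_k`-exact -/

omit [Fintype σ] [DecidableEq (σ → ℝ)] in
/-- `deg q(f) ≤ deg q · deg f` for a univariate `q` composed with a multivariate `f`. [folklore] -/
private theorem totalDegree_aeval_le (f : MvPolynomial σ ℝ) (q : Polynomial ℝ) :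
    (Polynomial.aeval f q).totalDegree ≤ q.natDegree * f.totalDegree := by
  rw [Polynomial.aeval_eq_sum_range]
  refine (totalDegree_finsetSum _ _).trans (Finset.sup_le fun i hi => ?_)
  refine (totalDegree_smul_le _ _).trans ((totalDegree_pow _ _).trans ?_)
  exact Nat.mul_le_mul_right _ (Nat.lt_succ_iff.mp (Finset.mem_range.mp hi))

omit [Fintype σ] [DecidableEq (σ → ℝ)] in
/-- `q(f)(x) = q(f(x))`. [folklore] -/
private theorem eval_aeval (f : MvPolynomial σ ℝ) (q : Polynomial ℝ) (x : σ → ℝ) :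
    eval x (Polynomial.aeval f q) = q.eval (eval x f) := by
  rw [Polynomial.aeval_eq_sum_range, map_sum, Polynomial.eval_eq_sum_range]
  refine Finset.sum_congr rfl fun i _ => ?_
  rw [smul_eq_C_mul, map_mul, eval_C, map_pow]

omit [Fintype σ] [DecidableEq (σ → ℝ)] in
/-- The mechanism behind **Exercise 7.55** (and the proof of Theorem 7.30): if a polynomial `f`
takes on `S` only values in a finite set `Λ ⊆ [0, ∞)`, then `f ≡ h²  mod I(S)` with
`deg h ≤ (|Λ| − 1) · deg f` — take `h = q(f)` where the univariate `q` (Lagrange interpolation,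
`deg q ≤ |Λ| − 1`) satisfies `q(v) = √v` for `v ∈ Λ`. [cite: BlekhermanParriloThomas2012, Ch. 7
Exercise 7.55 (statement: the vanishing ideal of the vertex set of a `(k+1)`-level polytope is
`TH_k`-exact; proof ours, extending the printed proof of Theorem 7.30)] -/
theorem exists_sq_sub_mem_vanishingIdeal_of_levels (S : Set (σ → ℝ)) (f : MvPolynomial σ ℝ)
    (Λ : Finset ℝ) (hΛ : ∀ v ∈ Λ, 0 ≤ v) (hf : ∀ x ∈ S, eval x f ∈ Λ) :
    ∃ h : MvPolynomial σ ℝ, h.totalDegree ≤ (Λ.card - 1) * f.totalDegree ∧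
      f - h ^ 2 ∈ vanishingIdeal ℝ S := by
  classical
  set q : Polynomial ℝ := Lagrange.interpolate Λ id (fun v => Real.sqrt v) with hq
  have hinj : Set.InjOn (id : ℝ → ℝ) (Λ : Set ℝ) := Set.injOn_id _
  refine ⟨Polynomial.aeval f q,
    (totalDegree_aeval_le f q).trans (Nat.mul_le_mul_right _ ?_), ?_⟩
  · have hdeg := Lagrange.degree_interpolate_lt (fun v => Real.sqrt v) hinj
    by_cases hq0 : q = 0
    · rw [hq0, Polynomial.natDegree_zero]; exact Nat.zero_le _
    · have h := (Polynomial.natDegree_lt_iff_degree_lt hq0).mpr hdeg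
      omega
  · rw [mem_vanishingIdeal_iff]
    intro x hx
    rw [aeval_eq_eval, map_sub, map_pow, sub_eq_zero, eval_aeval]
    have hfx := hf x hx
    have h := Lagrange.eval_interpolate_at_node (fun v => Real.sqrt v) hinj hfx
    simp only [id] at h
    rw [h, Real.sq_sqrt (hΛ _ hfx)]

omit [DecidableEq (σ → ℝ)] in
/-- **Exercise 7.55** (key step): an affine function taking at most `k + 1` distinct values, all
`≥ 0`, on `S` is `k`-sos modulo `I(S)`. [cite: BlekhermanParriloThomas2012, Ch. 7 Exercise 7.55
(statement; proof ours)] -/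
theorem isKSosMod_vanishingIdeal_of_levels (S : Set (σ → ℝ)) {α : ℝ} {a : σ → ℝ} {k : ℕ}
    (Λ : Finset ℝ) (hΛ : ∀ v ∈ Λ, 0 ≤ v) (hcard : Λ.card ≤ k + 1)
    (hf : ∀ x ∈ S, α + a ⬝ᵥ x ∈ Λ) : IsKSosMod (vanishingIdeal ℝ S) k (affinePoly α a) := by
  obtain ⟨h, hdeg, hmem⟩ := exists_sq_sub_mem_vanishingIdeal_of_levels S (affinePoly α a) Λ hΛ
    (fun x hx => by rw [eval_affinePoly]; exact hf x hx)
  refine isKSosMod_of_eq (fun _ : Fin 1 => h) (fun _ => hdeg.trans ?_) hmem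
    (by rw [Fin.sum_univ_one]; ring)
  calc (Λ.card - 1) * (affinePoly α a).totalDegree ≤ (Λ.card - 1) * 1 :=
        Nat.mul_le_mul_left _ (totalDegree_affinePoly_le α a)
    _ ≤ k := by omega

omit [DecidableEq (σ → ℝ)] in
/-- **Exercise 7.55** with the facet description as an explicit hypothesis: if
`cl(conv(S)) = {x : f_t(x) ≥ 0 (t ∈ T)}` for affine `f_t` each taking at most `k + 1` values
(all `≥ 0`) on `S` — "`conv(S)` is a `(k+1)`-level polytope" — then `TH_k(I(S)) = cl(conv(S))`.
[cite: BlekhermanParriloThomas2012, Ch. 7 Exercise 7.55 (statement; proof ours)] -/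
theorem thetaBody_vanishingIdeal_eq_of_levels (S : Set (σ → ℝ)) {T : Type*} (k : ℕ)
    (α : T → ℝ) (a : T → σ → ℝ) (Λ : T → Finset ℝ) (hΛ : ∀ t, ∀ v ∈ Λ t, 0 ≤ v)
    (hcard : ∀ t, (Λ t).card ≤ k + 1) (hf : ∀ t, ∀ x ∈ S, α t + a t ⬝ᵥ x ∈ Λ t)
    (hP : closure (convexHull ℝ S) = {x | ∀ t, 0 ≤ α t + a t ⬝ᵥ x}) :
    thetaBody (vanishingIdeal ℝ S) k = closure (convexHull ℝ S) := by
  refine Set.Subset.antisymm (fun x hx => ?_) ?_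
  · rw [hP]
    exact fun t => hx (α t) (a t)
      (isKSosMod_vanishingIdeal_of_levels S (Λ t) (hΛ t) (hcard t) (hf t))
  · exact (closure_mono (convexHull_mono (subset_zeroLocus_vanishingIdeal S))).trans
      closure_convexHull_zeroLocus_subset_thetaBody

omit [DecidableEq (σ → ℝ)] in
/-- **Exercise 7.55** for a finite vertex set: "the vanishing ideal of the set of vertices of a
`(k+1)`-level polytope is `TH_k`-exact". [cite: BlekhermanParriloThomas2012, Ch. 7
Exercise 7.55 (statement; proof ours) and Exercise 7.65 (where it is quoted)] -/
theorem isThetaExact_vanishingIdeal_of_levels (S : Finset (σ → ℝ)) {T : Type*} (k : ℕ)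
    (α : T → ℝ) (a : T → σ → ℝ) (Λ : T → Finset ℝ) (hΛ : ∀ t, ∀ v ∈ Λ t, 0 ≤ v)
    (hcard : ∀ t, (Λ t).card ≤ k + 1)
    (hf : ∀ t, ∀ x ∈ S, α t + a t ⬝ᵥ x ∈ Λ t)
    (hP : convexHull ℝ (S : Set (σ → ℝ)) = {x | ∀ t, 0 ≤ α t + a t ⬝ᵥ x}) :
    IsThetaExact (vanishingIdeal ℝ (S : Set (σ → ℝ))) k := by
  have hcl : closure (convexHull ℝ (S : Set (σ → ℝ))) = convexHull ℝ (S : Set (σ → ℝ)) :=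
    (Set.Finite.isCompact_convexHull ℝ S.finite_toSet).isClosed.closure_eq
  rw [IsThetaExact, zeroLocus_vanishingIdeal_eq, hcl]
  have h := thetaBody_vanishingIdeal_eq_of_levels (S : Set (σ → ℝ)) k α a Λ hΛ hcard
    (fun t x hx => hf t x (Finset.mem_coe.mp hx)) (by rw [hcl, hP])
  rw [h, hcl]

end Literature.Algebra.Polynomial.ThetaBodiesFinite
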